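import Summits.ResolutionOfSingularities.ResolutionOfSingularities.Theorems.FrobeniusLadderFRationalResolutionFixedPointBlowupRegular
import Summits.ResolutionOfSingularities.ResolutionOfSingularities.Theorems.FrobeniusLadderFRationalResolutionEtaleChartStalkBlowup
import HarnessLib

/-!
# Crux `FrobeniusLadder.FRationalResolution` (stmt-ResolutionOfSingularities-15317), line `redirect`,
# stub `stub_diagonalizableQuotientResolution` — **RESOLUTION OF VARIETIES WITH ISOLATED DIAGONALIZABLE-QUOTIENT POINTS WHOSE TORIC
# MODEL HAS A REGULAR VERTEX BLOW-UP** (general weight kernel; every field and characteristic; no Galois data)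

The model form of `…FixedPointResolution` (Veronese type): `…FixedPointBlowupRegular.isRegular_affineBlowup_maximalIdeal_of_parameters`
(p840843) + `Spec.stalkIso` + `…EtaleChartStalkBlowup.hasResolution_of_isolated_etale_stalkBlowup` (p840894).

* `isRegular_affineBlowup_stalk_of_parameters` — at the image `𝔮` of a fixed prime with homogeneous regular parameters `x, a` and weight
  kernel `⟨G⟩`: if `Bl_𝔳 Spec κ(𝔮)[χᵈ : d ∈ G]` is regular then `Bl_𝔪(Spec 𝒪_{Spec S₀, 𝔮})` is regular.
* ★★★★★★ `hasResolution_of_isolated_fixedPoints_of_model` — `X` integral, locally of finite type over a field, finitely many singular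
  points, each the image under an étale quotient chart `Spec S₀ → X` of a fixed prime with homogeneous regular parameters whose
  weight-kernel monomial algebra over `κ(𝔮)` has a regular vertex blow-up ⇒ `X` has a resolution of singularities.

So every cone-programme certificate (`veroneseCone_isRegular_affineBlowup`, `segreCone_isRegular_affineBlowup`, the fan probe's vertex
classes), once matched with the weight kernel of a fixed point, resolves the corresponding isolated quotient points of `X` — twisted or
not. Honest label: a sub-class of ONE leaf stub closed unconditionally; the stub, crux and summit are not closed. No definitions, no
named facts, no sorry. [cite: Kollar2007, §2.2] [cite: Kato1994, Thm. (3.2)] [cite: Matsumura1987, Thm. 8.11; Thm. 23.7; §32 p. 256]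
-/

noncomputable section

-- single-problem summit: the doubled namespace component is forced
set_option linter.dupNamespace false

open CategoryTheory AlgebraicGeometry TopologicalSpace IsLocalRing
open Literature.AlgebraicGeometry.Resolution

namespace Summit.ResolutionOfSingularities.ResolutionOfSingularities.Theorems.FRationalResolution.FixedPointResolution

universe w

/-- **Regular stalk blow-up at the image of a fixed point, from the toric model.** [cite: Kato1994, Thm. (3.2)] [cite: Kollar2007, §2.2] -/
theorem isRegular_affineBlowup_stalk_of_parameters {k' : Type} [Field k'] {A : Type w} [DecidableEq A] [AddCommGroup A]
    {S : Type} [CommRing S] [Algebra k' S] (𝒮 : A → Submodule k' S) [GradedAlgebra 𝒮] [Algebra.FiniteType k' S]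
    (hA : AddMonoid.IsTorsion A) (𝔔 : Ideal S) [𝔔.IsPrime]
    (hfix : ∀ a : A, a ≠ 0 → ∀ s ∈ 𝒮 a, s ∈ 𝔔)
    {n : ℕ} (x : Fin n → S) (a : Fin n → A) (hxa : ∀ i, x i ∈ 𝔔 ∧ x i ∈ 𝒮 (a i))
    (hspan : Ideal.span (algebraMap S (Localization.AtPrime 𝔔) '' Set.range x) =
      maximalIdeal (Localization.AtPrime 𝔔))
    (hn : (n : WithBot ℕ∞) = ringKrullDim (Localization.AtPrime 𝔔))
    (P : AddSubmonoid (Fin n →₀ ℕ)) (hP : ∀ m, m ∈ P ↔ Finsupp.weight a m = 0)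
    (G : Set (Fin n →₀ ℕ)) (hGfin : G.Finite) (hG0 : (0 : Fin n →₀ ℕ) ∉ G) (hGP : AddSubmonoid.closure G = P)
    (hreg : Scheme.IsRegular (affineBlowup (Ideal.span
      {v : ↥(Algebra.adjoin (ResidueField (Localization.AtPrime (𝔔.comap (algebraMap (𝒮 0) S))))
        ((fun d : Fin n →₀ ℕ => MvPolynomial.monomial d
          (1 : ResidueField (Localization.AtPrime (𝔔.comap (algebraMap (𝒮 0) S))))) '' G)) |
        ∃ d ∈ G, (v : MvPolynomial (Fin n) (ResidueField (Localization.AtPrime (𝔔.comap (algebraMap (𝒮 0) S))))) =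
          MvPolynomial.monomial d 1}))) :
    Scheme.IsRegular (affineBlowup (maximalIdeal ((Spec (.of (𝒮 0))).presheaf.stalk
      (⟨𝔔.comap (algebraMap (𝒮 0) S), inferInstance⟩ : Spec (.of (𝒮 0)))))) := by
  have h := FixedPointBlowupRegular.isRegular_affineBlowup_maximalIdeal_of_parameters 𝒮 hA 𝔔 hfix x a hxa hspan hn P hP
    G hGfin hG0 hGP (Localization.AtPrime (𝔔.comap (algebraMap (𝒮 0) S))) hreg
  let e := (Spec.stalkIso (.of (𝒮 0))
    (⟨𝔔.comap (algebraMap (𝒮 0) S), inferInstance⟩ : Spec (.of (𝒮 0)))).commRingCatIsoToRingEquiv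
  have h' := BlowupOrbitCentre.isRegular_affineBlowup_map_of_ringEquiv e.symm _ h
  rwa [PointBlowupOfCompletion.map_maximalIdeal_ringEquiv e.symm] at h'

/-- ★★★★★★ **RESOLUTION OF VARIETIES WITH ISOLATED DIAGONALIZABLE-QUOTIENT POINTS WHOSE TORIC MODEL HAS A REGULAR VERTEX BLOW-UP.**
`X` integral, locally of finite type over a field `k`, with finitely many singular points, each the image under an étale
`φ : Spec S₀ → X` (`S` of finite type over a field `k'`, graded by a torsion group `A`, `S₀ = 𝒮 0`) of the contraction of a
`D(A)`-fixed prime `𝔔` with homogeneous regular parameters `xᵢ ∈ S_{aᵢ}` (`n = dim S_𝔔`) whose weight kernel `{m : Σ mᵢ • aᵢ = 0}`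
is generated by a finite `G ∌ 0` such that the blow-up of `Spec κ(𝔮)[χᵈ : d ∈ G]` at its vertex is regular. Then `X` has a
resolution of singularities. [cite: Kollar2007, §2.2] [cite: Kato1994, Thm. (3.2)] [cite: Matsumura1987, Thm. 8.11; Thm. 23.7] -/
theorem hasResolution_of_isolated_fixedPoints_of_model (k : Type) [Field k] (X : Scheme.{0}) [IsIntegral X]
    (f : X ⟶ Spec (.of k)) [LocallyOfFiniteType f] (hfin : (Scheme.regularLocus X)ᶜ.Finite)
    (hchart : ∀ t : X, t ∉ Scheme.regularLocus X →
      ∃ (k' : Type) (_ : Field k') (A : Type) (_ : DecidableEq A) (_ : AddCommGroup A) (_ : AddMonoid.IsTorsion A)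
        (S : Type) (_ : CommRing S) (_ : Algebra k' S) (𝒮 : A → Submodule k' S) (_ : GradedAlgebra 𝒮)
        (_ : Algebra.FiniteType k' S) (φ : Spec (.of (𝒮 0)) ⟶ X) (_ : Etale φ)
        (𝔔 : Ideal S) (_ : 𝔔.IsPrime) (_ : ∀ a : A, a ≠ 0 → ∀ s ∈ 𝒮 a, s ∈ 𝔔)
        (n : ℕ) (x : Fin n → S) (a : Fin n → A) (P : AddSubmonoid (Fin n →₀ ℕ)) (G : Set (Fin n →₀ ℕ)),
        (∀ i, x i ∈ 𝔔 ∧ x i ∈ 𝒮 (a i)) ∧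
        Ideal.span (algebraMap S (Localization.AtPrime 𝔔) '' Set.range x) = maximalIdeal (Localization.AtPrime 𝔔) ∧
        (n : WithBot ℕ∞) = ringKrullDim (Localization.AtPrime 𝔔) ∧
        (∀ m, m ∈ P ↔ Finsupp.weight a m = 0) ∧ G.Finite ∧ (0 : Fin n →₀ ℕ) ∉ G ∧ AddSubmonoid.closure G = P ∧
        Scheme.IsRegular (affineBlowup (Ideal.span
          {v : ↥(Algebra.adjoin (ResidueField (Localization.AtPrime (𝔔.comap (algebraMap (𝒮 0) S))))
            ((fun d : Fin n →₀ ℕ => MvPolynomial.monomial d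
              (1 : ResidueField (Localization.AtPrime (𝔔.comap (algebraMap (𝒮 0) S))))) '' G)) |
            ∃ d ∈ G, (v : MvPolynomial (Fin n) (ResidueField (Localization.AtPrime (𝔔.comap (algebraMap (𝒮 0) S))))) =
              MvPolynomial.monomial d 1})) ∧
        φ ⟨𝔔.comap (algebraMap (𝒮 0) S), inferInstance⟩ = t) :
    Scheme.HasResolution X := by
  refine EtaleChartStalkBlowup.hasResolution_of_isolated_etale_stalkBlowup k X f hfin fun t ht => ?_
  obtain ⟨k', _, A, _, _, hA, S, _, _, 𝒮, _, _, φ, hφ, 𝔔, _, hfix, n, x, a, P, G, hxa, hspan, hn, hP, hGfin, hG0, hGP,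
    hreg, hφt⟩ := hchart t ht
  exact ⟨_, φ, hφ, _, hφt,
    isRegular_affineBlowup_stalk_of_parameters 𝒮 hA 𝔔 hfix x a hxa hspan hn P hP G hGfin hG0 hGP hreg⟩

end Summit.ResolutionOfSingularities.ResolutionOfSingularities.Theorems.FRationalResolution.FixedPointResolution

end
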